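import Summits.CriticalPhenomena.PercolationContinuityZ3.Theorems.Transplant.Z3DiagonalGraph
import HarnessLib

/-!
# The simplest tier-3 graph is a Cayley graph of `ℤ³`: `Cay(ℤ³; ±e₀, ±e₁, ±e₂, ±(e₀ + e₂))` — II. the `PlanarSkeletonNeg` structure
# `φ = (x₀, x₁)` (translations, central inversion, (μ)(ι)(κ)), the axis flips on the skeleton, connectedness

builds on p205010 (kernel theorem, internal audit signed; external expert review pending) — nothing in this file uses p205010.
Lane `prim-bschramm`, seat `prim-bschramm-p4` (gen 7; PART C3, class map); helper file (`--supports stmt-CriticalPhenomena-4575 --as helper`).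
Memo: `HOME/bschramm/P4-GENERAL.md` §18.  Continues `Z3DiagonalGraph` (the graph `dgGraph`, its automorphisms `dgShift`/`dgNeg`/`dgFlipX`/`dgFlipY`).
* `proj` (the skeleton map), `lift0` (layer-`0` copy of `ℤ²`), `cylSet ℓ = {|x₀|,|x₁| ≤ ℓ}` and its connectedness inside (`cyl_reachable_zero`:
  along the `e₂`-line, then the layer-`0` box via `box_induce_reachable_zero`);
* **`dgSkeletonNeg : PlanarSkeletonNeg dgGraph`** (base vertex `0`, `Δ = 8`), `exists_axis_flips` (the point group contains `(ℤ/2)²`),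
  `dgGraph_connected`.
[cite: KozmaNitzan2024, §4 p. 16 (Lemma 8: the lattice symmetries)] [cite: BenjaminiSchramm1996, §2, Conj. 4]
-/

noncomputable section

namespace Summit.CriticalPhenomena.PercolationContinuityZ3.Theorems.Transplant

namespace Z3Diag

open MeasureTheory Literature.Probability.Percolation Literature.Probability.LatticeModels SimpleGraph
open Literature.Barriers.CriticalPhenomena (IsQuasiTransitive IsGraphTransitive)
open scoped Classical

/-! ## §3 The planar skeleton `φ = (x₀, x₁)` with the central inversion; cylinders are connected -/

/-- The skeleton map `φ(x) = (x₀, x₁)`. [cite: KozmaNitzan2024, §4 p. 16] -/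
def proj (w : Site 3) : Site 2 := ![w 0, w 1]

/-- `proj` evaluated. [folklore] -/
@[simp] theorem proj_apply_zero (w : Site 3) : proj w 0 = w 0 := rfl
/-- `proj` evaluated. [folklore] -/
@[simp] theorem proj_apply_one (w : Site 3) : proj w 1 = w 1 := rfl

/-- `proj` is additive. [folklore] -/
theorem proj_add (u v : Site 3) : proj (u + v) = proj u + proj v := by
  ext i; fin_cases i <;> simp

/-- `proj` commutes with subtraction. [folklore] -/
theorem proj_sub (u v : Site 3) : proj (u - v) = proj u - proj v := by
  ext i; fin_cases i <;> simp

/-- `proj (−u) = −proj u`. [folklore] -/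
theorem proj_neg (u : Site 3) : proj (-u) = -proj u := by
  ext i; fin_cases i <;> simp

/-- `proj 0 = 0`. [folklore] -/
@[simp] theorem proj_zero : proj 0 = 0 := by
  ext i; fin_cases i <;> simp

/-- The layer-`0` lift `(x₀, x₁) ↦ (x₀, x₁, 0)`. [folklore] -/
def lift0 (x : Site 2) : Site 3 := ![x 0, x 1, 0]

/-- `lift0` evaluated. [folklore] -/
@[simp] theorem lift0_apply_zero (x : Site 2) : lift0 x 0 = x 0 := rfl
/-- `lift0` evaluated. [folklore] -/
@[simp] theorem lift0_apply_one (x : Site 2) : lift0 x 1 = x 1 := rfl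
/-- `lift0` evaluated. [folklore] -/
@[simp] theorem lift0_apply_two (x : Site 2) : lift0 x 2 = 0 := rfl

/-- `proj ∘ lift0 = id`. [folklore] -/
@[simp] theorem proj_lift0 (x : Site 2) : proj (lift0 x) = x := by
  ext i; fin_cases i <;> simp

/-- `lift0` is injective. [folklore] -/
theorem lift0_injective : Function.Injective lift0 := fun x y h => by
  rw [← proj_lift0 x, ← proj_lift0 y, h]

/-- The layer-`0` copy of a lattice step of `ℤ²` is an edge of `dgGraph`. [folklore] -/
theorem dgGraph_adj_lift0 {x y : Site 2} (h : (zdGraph 2).Adj x y) : dgGraph.Adj (lift0 x) (lift0 y) := by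
  rw [dgGraph_adj_iff, mem_dgGens_iff]
  obtain ⟨i, h | h⟩ := (zdGraph_adj_iff x y).1 h
  · fin_cases i
    · exact Or.inl (by rw [h]; ext j; fin_cases j <;> simp [ev])
    · exact Or.inr (Or.inr (Or.inl (by rw [h]; ext j; fin_cases j <;> simp [ev])))
  · fin_cases i
    · exact Or.inr (Or.inl (by rw [h]; ext j; fin_cases j <;> simp [ev]))
    · exact Or.inr (Or.inr (Or.inr (Or.inl (by rw [h]; ext j; fin_cases j <;> simp [ev]))))

/-- The cylinder set of half-width `ℓ` at `0`: `{|x₀| ≤ ℓ, |x₁| ≤ ℓ}` (the whole `e₂`-line inside). [folklore] -/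
def cylSet (ℓ : ℕ) : Set (Site 3) := {w | proj w - proj 0 ∈ box 2 ℓ}

/-- Membership in the cylinder. [folklore] -/
theorem mem_cylSet_iff {ℓ : ℕ} {w : Site 3} :
    w ∈ cylSet ℓ ↔ (-(ℓ : ℤ) ≤ w 0 ∧ w 0 ≤ ℓ) ∧ (-(ℓ : ℤ) ≤ w 1 ∧ w 1 ≤ ℓ) := by
  simp [cylSet, mem_box, Fin.forall_fin_two]

/-- `0` lies in every cylinder. [folklore] -/
theorem zero_mem_cylSet (ℓ : ℕ) : (0 : Site 3) ∈ cylSet ℓ := by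
  rw [mem_cylSet_iff]; simp

/-- The `e₂`-step stays in the cylinder and is an edge. [folklore] -/
theorem add_ev2_mem_cylSet {ℓ : ℕ} {w : Site 3} (hw : w ∈ cylSet ℓ) (σ : ℤ) (hσ : σ = 1 ∨ σ = -1) :
    w + σ • ev 2 ∈ cylSet ℓ ∧ dgGraph.Adj w (w + σ • ev 2) := by
  refine ⟨?_, ?_⟩
  · rw [mem_cylSet_iff] at hw ⊢
    simpa [ev] using hw
  · rw [dgGraph_adj_iff, add_sub_cancel_left, mem_dgGens_iff]
    rcases hσ with rfl | rfl
    · exact Or.inr (Or.inr (Or.inr (Or.inr (Or.inl (one_smul _ _)))))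
    · exact Or.inr (Or.inr (Or.inr (Or.inr (Or.inr (Or.inl (neg_one_smul _ _))))))

/-- Inside the cylinder, `w` is joined to `w + n σ e₂` along the `e₂`-line. [folklore] -/
theorem cyl_reachable_add_ev2 (ℓ : ℕ) {σ : ℤ} (hσ : σ = 1 ∨ σ = -1) :
    ∀ (n : ℕ) (w : Site 3) (hw : w ∈ cylSet ℓ),
      ∃ h' : w + ((n : ℤ) * σ) • ev 2 ∈ cylSet ℓ, (dgGraph.induce (cylSet ℓ)).Reachable ⟨w, hw⟩ ⟨w + ((n : ℤ) * σ) • ev 2, h'⟩ := by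
  intro n
  induction n with
  | zero => intro w hw; exact ⟨by simpa using hw, by simp⟩
  | succ n ih =>
    intro w hw
    obtain ⟨h1, hadj⟩ := add_ev2_mem_cylSet hw σ hσ
    obtain ⟨h2, hr⟩ := ih (w + σ • ev 2) h1
    have heq : w + σ • ev 2 + ((n : ℤ) * σ) • ev 2 = w + (((n + 1 : ℕ) : ℤ) * σ) • ev 2 := by
      rw [add_assoc, ← add_smul]; congr 1; push_cast; ring_nf
    refine ⟨heq ▸ h2, ?_⟩
    have hstep : (dgGraph.induce (cylSet ℓ)).Adj ⟨w, hw⟩ ⟨w + σ • ev 2, h1⟩ := hadj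
    have hr' : (dgGraph.induce (cylSet ℓ)).Reachable ⟨w + σ • ev 2, h1⟩ ⟨w + (((n + 1 : ℕ) : ℤ) * σ) • ev 2, heq ▸ h2⟩ := by
      convert hr using 2; exact heq.symm
    exact hstep.reachable.trans hr'

/-- Inside the cylinder, every `w` is joined to its layer-`0` projection `(w₀, w₁, 0)`. [folklore] -/
theorem cyl_reachable_lift0 (ℓ : ℕ) (w : Site 3) (hw : w ∈ cylSet ℓ) :
    ∃ h' : lift0 (proj w) ∈ cylSet ℓ, (dgGraph.induce (cylSet ℓ)).Reachable ⟨w, hw⟩ ⟨lift0 (proj w), h'⟩ := by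
  -- go down (or up) `|w 2|` steps
  rcases le_or_gt 0 (w 2) with hz | hz
  · obtain ⟨h', hr⟩ := cyl_reachable_add_ev2 ℓ (σ := -1) (Or.inr rfl) (w 2).toNat w hw
    have heq : w + (((w 2).toNat : ℤ) * (-1)) • ev 2 = lift0 (proj w) := by
      rw [Int.toNat_of_nonneg hz]; ext i; fin_cases i <;> simp [ev]
    exact ⟨heq ▸ h', by convert hr using 2; exact heq.symm⟩
  · obtain ⟨h', hr⟩ := cyl_reachable_add_ev2 ℓ (σ := 1) (Or.inl rfl) (-w 2).toNat w hw
    have heq : w + (((-w 2).toNat : ℤ) * 1) • ev 2 = lift0 (proj w) := by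
      rw [Int.toNat_of_nonneg (by omega)]; ext i; fin_cases i <;> simp [ev]
    exact ⟨heq ▸ h', by convert hr using 2; exact heq.symm⟩

/-- The lift of a box point lies in the cylinder. [folklore] -/
theorem lift0_mem_cylSet {ℓ : ℕ} {x : Site 2} (hx : x ∈ box 2 ℓ) : lift0 x ∈ cylSet ℓ := by
  rw [cylSet, Set.mem_setOf_eq, proj_lift0, proj_zero, sub_zero]; exact hx

/-- The layer-`0` copy of the box, as a graph homomorphism into the cylinder. [folklore] -/
def liftHom (ℓ : ℕ) : (zdGraph 2).induce (↑(box 2 ℓ) : Set (Site 2)) →g dgGraph.induce (cylSet ℓ) where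
  toFun x := ⟨lift0 x.1, lift0_mem_cylSet (Finset.mem_coe.1 x.2)⟩
  map_rel' := fun hab => dgGraph_adj_lift0 hab

/-- `liftHom` on the centre. [folklore] -/
theorem liftHom_zero (ℓ : ℕ) : liftHom ℓ ⟨0, Finset.mem_coe.2 (zero_mem_box 2 ℓ)⟩ = ⟨0, zero_mem_cylSet ℓ⟩ := by
  apply Subtype.ext
  show lift0 0 = 0
  ext i; fin_cases i <;> rfl

/-- **(κ) the induced cylinders are connected**: every cylinder vertex is joined inside the cylinder to `0` — along its `e₂`-line to
layer `0`, then through the layer-`0` copy of the box (`box_induce_reachable_zero`). [folklore] -/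
theorem cyl_reachable_zero (ℓ : ℕ) (w : Site 3) (hw : w ∈ cylSet ℓ) :
    (dgGraph.induce (cylSet ℓ)).Reachable ⟨w, hw⟩ ⟨0, zero_mem_cylSet ℓ⟩ := by
  have hw1 : proj w ∈ box 2 ℓ := by simpa [cylSet] using hw
  have h0 : (dgGraph.induce (cylSet ℓ)).Reachable (liftHom ℓ ⟨proj w, Finset.mem_coe.2 hw1⟩) ⟨0, zero_mem_cylSet ℓ⟩ := by
    rw [← liftHom_zero ℓ]
    exact (box_induce_reachable_zero ℓ hw1).map (liftHom ℓ)
  obtain ⟨h', hr⟩ := cyl_reachable_lift0 ℓ w hw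
  exact hr.trans h0

/-- **The skeleton `φ = (x₀, x₁)` with translations and the central inversion** (base vertex `0`, `Δ = 8`): a `PlanarSkeletonNeg` with THIN
fibres (the `e₂`-lines). [cite: KozmaNitzan2024, §4 p. 16] -/
def dgSkeletonNeg : PlanarSkeletonNeg dgGraph where
  φ := proj
  lip := by
    intro u v huv i
    have h := abs_apply_le_of_mem_dgGens ((dgGraph_adj_iff u v).1 huv)
    fin_cases i
    · have := h 0; rw [abs_sub_comm]; simpa using this
    · have := h 1; rw [abs_sub_comm]; simpa using this
  types := {0}
  frame := fun v => ⟨0, Finset.mem_singleton_self _, dgShift v, by simp, fun w => by simp [proj_add, add_comm]⟩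
  neg := fun t ht => by
    rw [Finset.mem_singleton] at ht
    subst ht
    exact ⟨dgNeg, by simp, fun w => by simp [proj_neg]⟩
  Δ := 8
  degree_le := dgGraph_degree_le
  step := by
    intro v i σ
    refine ⟨v + lift0 (Pi.single i (σ : ℤ)), ?_, by rw [proj_add, proj_lift0]⟩
    rw [dgGraph_adj_iff, add_sub_cancel_left, mem_dgGens_iff]
    rcases Int.units_eq_one_or σ with rfl | rfl <;> fin_cases i
    · exact Or.inl (by ext j; fin_cases j <;> simp [ev])
    · exact Or.inr (Or.inr (Or.inl (by ext j; fin_cases j <;> simp [ev])))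
    · exact Or.inr (Or.inl (by ext j; fin_cases j <;> simp [ev]))
    · exact Or.inr (Or.inr (Or.inr (Or.inl (by ext j; fin_cases j <;> simp [ev]))))
  cyl_connected := by
    intro t ht ℓ _
    rw [Finset.mem_singleton] at ht
    subst ht
    show (dgGraph.induce (cylSet ℓ)).Connected
    haveI : Nonempty (cylSet ℓ) := ⟨⟨0, zero_mem_cylSet ℓ⟩⟩
    exact ⟨fun x y => (cyl_reachable_zero ℓ x.1 x.2).trans (cyl_reachable_zero ℓ y.1 y.2).symm⟩

/-- The base vertices: `{0}`. [folklore] -/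
@[simp] theorem dgSkeletonNeg_types : dgSkeletonNeg.types = {0} := rfl

/-- The skeleton map is `proj`. [folklore] -/
@[simp] theorem dgSkeletonNeg_φ : dgSkeletonNeg.φ = proj := rfl

/-- The cylinder of the skeleton at `0` is `cylSet`. [folklore] -/
theorem dgSkeletonNeg_cyl (ℓ : ℕ) : dgSkeletonNeg.cyl (0 : Site 3) ℓ = cylSet ℓ := rfl

/-- **The two axis flips realise `(ℤ/2)²` on the skeleton** (together with `dgNeg = dgFlipX ∘ dgFlipY`): automorphisms fixing `0` that
reverse exactly one skeleton coordinate each — the point group route D″ v2 uses for its side-halves (P4-GENERAL §16.7).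
[cite: KozmaNitzan2024, §4 Lemma 8 p. 16] -/
theorem exists_axis_flips :
    (∃ ρ : dgGraph ≃g dgGraph, ρ 0 = 0 ∧ ∀ w, proj (ρ w) = ![-(proj w 0), proj w 1]) ∧
      (∃ ρ : dgGraph ≃g dgGraph, ρ 0 = 0 ∧ ∀ w, proj (ρ w) = ![proj w 0, -(proj w 1)]) := by
  refine ⟨⟨dgFlipX, ?_, fun w => ?_⟩, ⟨dgFlipY, ?_, fun w => ?_⟩⟩
  · ext i; fin_cases i <;> simp
  · ext i; fin_cases i <;> simp
  · ext i; fin_cases i <;> simp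
  · ext i; fin_cases i <;> simp

/-- **The graph is connected** (every vertex lies in some cylinder about `0`, connected by (κ)). [folklore] -/
theorem dgGraph_connected : dgGraph.Connected := by
  haveI : Nonempty (Site 3) := ⟨0⟩
  refine ⟨fun x y => ?_⟩
  have key : ∀ w : Site 3, dgGraph.Reachable w 0 := by
    intro w
    set ℓ : ℕ := max (w 0).natAbs (w 1).natAbs with hℓ
    have hw : w ∈ cylSet ℓ := by
      rw [mem_cylSet_iff]; omega
    exact (cyl_reachable_zero ℓ w hw).map (SimpleGraph.Embedding.induce _).toHom
  exact (key x).trans (key y).symm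

end Z3Diag

end Summit.CriticalPhenomena.PercolationContinuityZ3.Theorems.Transplant

end
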